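import Summits.SmoothPoincare4.SmoothPoincare4.Theorems.ConvexBisectionAcyclicBisectionExistsBeltFibreDirections
import HarnessLib

/-!
# The framed `r`-longitude of an attaching circle, III: fibre framings through the sphere part of
# the tube
(node T3c-1 `node_belt_isotopic_pushoff` of the sub-goal T3 of stub `stub_steinRealisation` (NF6), line
`modp-braid-orbits`, crux `ConvexBisection.AcyclicBisectionExists`, item stmt-SmoothPoincare4-10508;
wave 3, worker Z5, lead c5; stages (3a) and (3c) of V6-REPORT §2)

For an attaching map `h̄ : T → W` of a 2-handle this file introduces the framings of curves in the sphere
part `h̄(T ∩ ∂D⁴)` given by FIBRE directions of the coordinates `(ψ, v) ↦ depthLine ψ v 0`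
(`…BeltFibreDirections.lean`):

* §1 the fibre arc `fibreArc ψ v ζ ε = depthLine ψ (v + ε ζ) 0 ∈ T`, smooth at `ε = 0` with chart velocity
  `Dι⁻¹ (fibreVec ψ v ζ)` (`mfderiv_fibreArc_zero`), and **`tubeFibreFraming h̄ ψ v ζ`** — the velocity of
  `ε ↦ h̄ (fibreArc ψ v ζ ε)` — `= dh̄ (Dι⁻¹ fibreVec)` (`tubeFibreFraming_eq_mfderiv`), tangent to `∂W`
  (`tubeFibreFraming_mem_boundaryTangentSpace`);
* §2 `tubeFibreFraming` as the partial derivative of the sphere-tube map `(ψ, v) ↦ h̄ (depthLine ψ v 0)` in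
  the fibre direction (`tubeFibreFraming_eq_mfderiv_prod`) and its continuity into `TW` along continuous
  data (`continuous_tubeFibreFraming`: the tangent map applied to a section with zero `𝕊¹`-component);
* §3 registered helper `helper_belt_fibreFraming`.

Everything is proved; no named facts.

## References
* A. A. Kosinski, *Differential Manifolds*, Academic Press (1993), VI §5 (5.1), §6. [Kosinski1993]
* R. C. Kirby, *The Topology of 4-Manifolds*, LNM 1374 (1989), Ch. I §2 (framings). [Kirby1989]
-/

noncomputable section

-- the prescribed namespace `Summit.<P>.<Sub>.…` duplicates `SmoothPoincare4` (P = Sub)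
set_option linter.dupNamespace false

open scoped Manifold ContDiff Topology RealInnerProductSpace
open Set Function Metric Real Bundle

namespace Summit.SmoothPoincare4.SmoothPoincare4.Theorems.AcyclicBisectionExists.ModpBraidOrbits

open Literature.Topology.FourManifolds Literature.Topology.FourManifolds.HandleAttachingMap
  Literature.Geometry.Symplectic

/-! ### §1 The fibre arc and the fibre framing -/

/-- **The fibre arc** `ε ↦ depthLine ψ (v + εζ) 0 ∈ T` through the sphere point `(√(1-‖v‖²) ψ, v)`.
[folklore] -/
def fibreArc (ψ : sphere (0 : EuclideanSpace ℝ (Fin 2)) 1) (v ζ : EuclideanSpace ℝ (Fin 2)) (ε : ℝ) :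
    ↥(handleTube 3 2) :=
  depthLine ψ (v + ε • ζ) 0

/-- The fibre arc starts at the sphere point. [folklore] -/
@[simp] theorem fibreArc_zero (ψ : sphere (0 : EuclideanSpace ℝ (Fin 2)) 1) (v ζ : EuclideanSpace ℝ (Fin 2)) :
    fibreArc ψ v ζ 0 = depthLine ψ v 0 := by
  simp [fibreArc]

/-- Near `ε = 0` the fibre stays in the open unit disc (`‖v‖ < 1`). [folklore] -/
theorem eventually_norm_line_lt (v ζ : EuclideanSpace ℝ (Fin 2)) (hv : ‖v‖ < 1) :
    ∀ᶠ ε : ℝ in 𝓝 0, ‖v + ε • ζ‖ < 1 := by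
  have hc : Continuous fun ε : ℝ => ‖v + ε • ζ‖ := by fun_prop
  exact hc.continuousAt.eventually_lt continuousAt_const (by simpa using hv)

/-- **The fibre arc, read in `ℝ⁴`, has velocity `fibreVec` at `ε = 0`** (`‖v‖ < 1`). [folklore] -/
theorem hasDerivAt_coe_coe_fibreArc (ψ : sphere (0 : EuclideanSpace ℝ (Fin 2)) 1) {v : EuclideanSpace ℝ (Fin 2)}
    (hv : ‖v‖ < 1) (ζ : EuclideanSpace ℝ (Fin 2)) :
    HasDerivAt (fun ε : ℝ => (((fibreArc ψ v ζ ε : ↥(handleTube 3 2)) :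
      closedBall (0 : EuclideanSpace ℝ (Fin 4)) 1) : EuclideanSpace ℝ (Fin 4))) (fibreVec ψ v ζ) 0 := by
  refine (hasDerivAt_mkVec_line ψ hv ζ).congr_of_eventuallyEq ?_
  filter_upwards [eventually_norm_line_lt v ζ hv] with ε hε
  have hpos : 0 < 1 - 0 - ‖v + ε • ζ‖ ^ 2 := by nlinarith [norm_nonneg (v + ε • ζ)]
  exact tubeVec_depthLine ψ (v + ε • ζ) le_rfl hpos

/-- **The fibre arc is smooth at `ε = 0`** (`‖v‖ < 1`). [folklore] -/
theorem contMDiffAt_fibreArc (ψ : sphere (0 : EuclideanSpace ℝ (Fin 2)) 1) {v : EuclideanSpace ℝ (Fin 2)}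
    (hv : ‖v‖ < 1) (ζ : EuclideanSpace ℝ (Fin 2)) :
    ContMDiffAt 𝓘(ℝ, ℝ) (𝓡∂ 4) ∞ (fibreArc ψ v ζ) 0 := by
  have hU : IsOpen ((univ : Set (sphere (0 : EuclideanSpace ℝ (Fin 2)) 1)) ×ˢ ball (0 : EuclideanSpace ℝ (Fin 2)) 1) :=
    isOpen_univ.prod isOpen_ball
  have hmem : ((ψ, v + (0 : ℝ) • ζ) : (sphere (0 : EuclideanSpace ℝ (Fin 2)) 1) × EuclideanSpace ℝ (Fin 2)) ∈
      (univ : Set (sphere (0 : EuclideanSpace ℝ (Fin 2)) 1)) ×ˢ ball (0 : EuclideanSpace ℝ (Fin 2)) 1 := by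
    refine ⟨mem_univ _, ?_⟩; simpa using hv
  have h1 : ContMDiffAt ((𝓡 1).prod 𝓘(ℝ, EuclideanSpace ℝ (Fin 2))) (𝓡∂ 4) ∞
      (fun q : (sphere (0 : EuclideanSpace ℝ (Fin 2)) 1) × EuclideanSpace ℝ (Fin 2) => depthLine q.1 q.2 0)
      (ψ, v + (0 : ℝ) • ζ) :=
    (contMDiffOn_depthLine_zero _ hmem).contMDiffAt (hU.mem_nhds hmem)
  have h2 : ContMDiffAt 𝓘(ℝ, ℝ) ((𝓡 1).prod 𝓘(ℝ, EuclideanSpace ℝ (Fin 2))) ∞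
      (fun ε : ℝ => ((ψ, v + ε • ζ) : (sphere (0 : EuclideanSpace ℝ (Fin 2)) 1) × EuclideanSpace ℝ (Fin 2))) 0 :=
    contMDiffAt_const.prodMk ((contDiff_const.add (contDiff_id.smul contDiff_const)).contMDiff 0)
  exact h1.comp 0 h2

/-- **The chart velocity of the fibre arc at `ε = 0` is `Dι⁻¹ (fibreVec ψ v ζ)`** (`‖v‖ < 1`). [folklore] -/
theorem mfderiv_fibreArc_zero (ψ : sphere (0 : EuclideanSpace ℝ (Fin 2)) 1) {v : EuclideanSpace ℝ (Fin 2)}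
    (hv : ‖v‖ < 1) (ζ : EuclideanSpace ℝ (Fin 2)) :
    mfderiv 𝓘(ℝ, ℝ) (𝓡∂ 4) (fibreArc ψ v ζ) 0 (1 : ℝ) =
      (closedBallCoeDeriv ((depthLine ψ v 0 : ↥(handleTube 3 2)) : closedBall (0 : EuclideanSpace ℝ (Fin 4)) 1)).symm
        (fibreVec ψ v ζ) := by
  have h0 : fibreArc ψ v ζ 0 = depthLine ψ v 0 := fibreArc_zero ψ v ζ
  set pt : ↥(handleTube 3 2) := depthLine ψ v 0 with hpt
  have hγd : MDifferentiableAt 𝓘(ℝ, ℝ) (𝓡∂ 4) (fibreArc ψ v ζ) 0 :=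
    (contMDiffAt_fibreArc ψ hv ζ).mdifferentiableAt (by simp)
  have hval : HasMFDerivAt (𝓡∂ 4) 𝓘(ℝ, EuclideanSpace ℝ (Fin 4))
      (fun y : ↥(handleTube 3 2) => ((y : closedBall (0 : EuclideanSpace ℝ (Fin 4)) 1) : EuclideanSpace ℝ (Fin 4)))
      (fibreArc ψ v ζ 0) (closedBallCoeDeriv ((fibreArc ψ v ζ 0 : ↥(handleTube 3 2)) :
        closedBall (0 : EuclideanSpace ℝ (Fin 4)) 1) : EuclideanSpace ℝ (Fin 4) →L[ℝ] EuclideanSpace ℝ (Fin 4)) :=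
    hasMFDerivAt_restrict_opens (handleTube 3 2) (hasMFDerivAt_coe_closedBall _)
  have h2 := hval.comp 0 hγd.hasMFDerivAt
  have h1 : HasMFDerivAt 𝓘(ℝ, ℝ) 𝓘(ℝ, EuclideanSpace ℝ (Fin 4))
      ((fun y : ↥(handleTube 3 2) => ((y : closedBall (0 : EuclideanSpace ℝ (Fin 4)) 1) : EuclideanSpace ℝ (Fin 4))) ∘
        fibreArc ψ v ζ) 0
      (ContinuousLinearMap.smulRight (1 : ℝ →L[ℝ] ℝ) (fibreVec ψ v ζ)) :=
    (hasDerivAt_coe_coe_fibreArc ψ hv ζ).hasFDerivAt.hasMFDerivAt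
  have h3 := h2.mfderiv.symm.trans h1.mfderiv
  have h4 : closedBallCoeDeriv ((fibreArc ψ v ζ 0 : ↥(handleTube 3 2)) : closedBall (0 : EuclideanSpace ℝ (Fin 4)) 1)
      (mfderiv 𝓘(ℝ, ℝ) (𝓡∂ 4) (fibreArc ψ v ζ) 0 (1 : ℝ)) = (1 : ℝ) • fibreVec ψ v ζ :=
    congrArg (fun L : ℝ →L[ℝ] EuclideanSpace ℝ (Fin 4) => L 1) h3
  rw [one_smul, h0] at h4
  exact ((closedBallCoeDeriv (pt : closedBall (0 : EuclideanSpace ℝ (Fin 4)) 1)).symm_apply_apply _).symm.trans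
    (congrArg (closedBallCoeDeriv (pt : closedBall (0 : EuclideanSpace ℝ (Fin 4)) 1)).symm h4)

variable {W : Type*} [TopologicalSpace W] [ChartedSpace (EuclideanHalfSpace 4) W]

/-- **The fibre framing** `tubeFibreFraming h̄ ψ v ζ ∈ T_{h̄(√(1-‖v‖²)ψ, v)} W`: the velocity at `ε = 0` of
the image `ε ↦ h̄ (depthLine ψ (v + εζ) 0)` of the fibre arc. [cite: Kirby1989, Ch. I §2] -/
def tubeFibreFraming (f : HandleAttachingMap 3 2 W) (ψ : sphere (0 : EuclideanSpace ℝ (Fin 2)) 1)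
    (v ζ : EuclideanSpace ℝ (Fin 2)) : EuclideanSpace ℝ (Fin 4) :=
  mfderiv 𝓘(ℝ, ℝ) (𝓡∂ 4) (fun ε : ℝ => f.toFun (fibreArc ψ v ζ ε)) 0 (1 : ℝ)

/-- **The fibre framing is `dh̄ (Dι⁻¹ fibreVec)`** (chain rule through the fibre arc; `‖v‖ < 1`).
[folklore] -/
theorem tubeFibreFraming_eq_mfderiv (f : HandleAttachingMap 3 2 W) (ψ : sphere (0 : EuclideanSpace ℝ (Fin 2)) 1)
    {v : EuclideanSpace ℝ (Fin 2)} (hv : ‖v‖ < 1) (ζ : EuclideanSpace ℝ (Fin 2)) :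
    tubeFibreFraming f ψ v ζ =
      mfderiv (𝓡∂ 4) (𝓡∂ 4) f.toFun (depthLine ψ v 0)
        ((closedBallCoeDeriv ((depthLine ψ v 0 : ↥(handleTube 3 2)) :
          closedBall (0 : EuclideanSpace ℝ (Fin 4)) 1)).symm (fibreVec ψ v ζ)) := by
  have hγd : MDifferentiableAt 𝓘(ℝ, ℝ) (𝓡∂ 4) (fibreArc ψ v ζ) 0 :=
    (contMDiffAt_fibreArc ψ hv ζ).mdifferentiableAt (by simp)
  unfold tubeFibreFraming
  rw [show (fun ε : ℝ => f.toFun (fibreArc ψ v ζ ε)) = f.toFun ∘ fibreArc ψ v ζ from rfl,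
    mfderiv_comp 0 (mdifferentiableAt_handleAttachingMap f _) hγd]
  show mfderiv (𝓡∂ 4) (𝓡∂ 4) f.toFun (fibreArc ψ v ζ 0) (mfderiv 𝓘(ℝ, ℝ) (𝓡∂ 4) (fibreArc ψ v ζ) 0 (1 : ℝ)) = _
  rw [mfderiv_fibreArc_zero ψ hv ζ, fibreArc_zero]

/-- **The fibre framing is tangent to `∂W`** (`‖v‖ < 1`). [folklore] -/
theorem tubeFibreFraming_mem_boundaryTangentSpace [IsManifold (𝓡∂ 4) ∞ W] (f : HandleAttachingMap 3 2 W)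
    (ψ : sphere (0 : EuclideanSpace ℝ (Fin 2)) 1) {v : EuclideanSpace ℝ (Fin 2)} (hv : ‖v‖ < 1)
    (ζ : EuclideanSpace ℝ (Fin 2)) : tubeFibreFraming f ψ v ζ ∈ boundaryTangentSpace := by
  have hpos : 0 < 1 - 0 - ‖v‖ ^ 2 := by nlinarith [norm_nonneg v]
  have hvec : (((depthLine ψ v 0 : ↥(handleTube 3 2)) : closedBall (0 : EuclideanSpace ℝ (Fin 4)) 1) :
      EuclideanSpace ℝ (Fin 4)) = mkVec (ψ : EuclideanSpace ℝ (Fin 2)) v 0 := tubeVec_depthLine ψ v le_rfl hpos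
  rw [tubeFibreFraming_eq_mfderiv f ψ hv ζ]
  refine mfderiv_handleAttachingMap_apply_zero f (norm_tubeVec_depthLine_zero ψ v) ?_
  rw [hvec]; exact inner_mkVec_fibreVec ψ hv ζ


/-! ### §2 The fibre framing as a partial derivative; continuity into `TW` -/

/-- **The sphere-tube map** `(ψ, v) ↦ h̄ (depthLine ψ v 0)` of an attaching map (as a point of `W`; its
lift to `∂W` is the boundary tube `h̄.boundaryTube`). [cite: Kosinski1993, VI §5 (5.1)] -/
def sphereTubeMap (f : HandleAttachingMap 3 2 W)
    (q : (sphere (0 : EuclideanSpace ℝ (Fin 2)) 1) × EuclideanSpace ℝ (Fin 2)) : W :=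
  f.toFun (depthLine q.1 q.2 0)

/-- The sphere-tube map is smooth on the unit tube `𝕊¹ × B(0, 1)`. [folklore] -/
theorem contMDiffOn_sphereTubeMap [IsManifold (𝓡∂ 4) ∞ W] (f : HandleAttachingMap 3 2 W) :
    ContMDiffOn ((𝓡 1).prod 𝓘(ℝ, EuclideanSpace ℝ (Fin 2))) (𝓡∂ 4) ∞ (sphereTubeMap f)
      ((univ : Set (sphere (0 : EuclideanSpace ℝ (Fin 2)) 1)) ×ˢ ball (0 : EuclideanSpace ℝ (Fin 2)) 1) :=
  f.isSmoothEmbedding.contMDiff.comp_contMDiffOn contMDiffOn_depthLine_zero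

/-- The velocity of the line `ε ↦ v + εζ` is `ζ` (`mfderiv` form). [folklore] -/
theorem mfderiv_line (v ζ : EuclideanSpace ℝ (Fin 2)) :
    mfderiv 𝓘(ℝ, ℝ) 𝓘(ℝ, EuclideanSpace ℝ (Fin 2)) (fun ε : ℝ => v + ε • ζ) 0 (1 : ℝ) = ζ := by
  have hline : HasDerivAt (fun ε : ℝ => v + ε • ζ) ζ 0 := by
    simpa using ((hasDerivAt_id (0 : ℝ)).smul_const ζ).const_add v
  have h := hline.hasFDerivAt.hasMFDerivAt.mfderiv
  rw [h]
  show (ContinuousLinearMap.smulRight (1 : ℝ →L[ℝ] ℝ) ζ) 1 = ζ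
  simp

/-- **The fibre framing is the partial derivative of the sphere-tube map in the fibre direction**:
`tubeFibreFraming h̄ ψ v ζ = d(sphereTubeMap h̄)_{(ψ, v)} (0, ζ)` (`‖v‖ < 1`). [folklore] -/
theorem tubeFibreFraming_eq_mfderiv_prod [IsManifold (𝓡∂ 4) ∞ W] (f : HandleAttachingMap 3 2 W)
    (ψ : sphere (0 : EuclideanSpace ℝ (Fin 2)) 1) {v : EuclideanSpace ℝ (Fin 2)} (hv : ‖v‖ < 1)
    (ζ : EuclideanSpace ℝ (Fin 2)) :
    tubeFibreFraming f ψ v ζ =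
      mfderiv ((𝓡 1).prod 𝓘(ℝ, EuclideanSpace ℝ (Fin 2))) (𝓡∂ 4) (sphereTubeMap f) (ψ, v)
        (((0 : EuclideanSpace ℝ (Fin 1)), ζ) : TangentSpace ((𝓡 1).prod 𝓘(ℝ, EuclideanSpace ℝ (Fin 2)))
          ((ψ, v) : (sphere (0 : EuclideanSpace ℝ (Fin 2)) 1) × EuclideanSpace ℝ (Fin 2))) := by
  have hU : IsOpen ((univ : Set (sphere (0 : EuclideanSpace ℝ (Fin 2)) 1)) ×ˢ ball (0 : EuclideanSpace ℝ (Fin 2)) 1) :=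
    isOpen_univ.prod isOpen_ball
  have hmem : ((ψ, v) : (sphere (0 : EuclideanSpace ℝ (Fin 2)) 1) × EuclideanSpace ℝ (Fin 2)) ∈
      (univ : Set (sphere (0 : EuclideanSpace ℝ (Fin 2)) 1)) ×ˢ ball (0 : EuclideanSpace ℝ (Fin 2)) 1 :=
    ⟨mem_univ _, by simpa using hv⟩
  have hF : ContMDiffAt ((𝓡 1).prod 𝓘(ℝ, EuclideanSpace ℝ (Fin 2))) (𝓡∂ 4) ∞ (sphereTubeMap f) (ψ, v) :=
    (contMDiffOn_sphereTubeMap f _ hmem).contMDiffAt (hU.mem_nhds hmem)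
  have hd : MDifferentiableAt ((𝓡 1).prod 𝓘(ℝ, EuclideanSpace ℝ (Fin 2))) (𝓡∂ 4) (sphereTubeMap f) (ψ, v) :=
    hF.mdifferentiableAt (by simp)
  rw [mfderiv_prod_eq_add_apply hd]
  have h0 : (mfderiv (𝓡 1) (𝓡∂ 4) (fun z : sphere (0 : EuclideanSpace ℝ (Fin 2)) 1 =>
      sphereTubeMap f (z, ((ψ, v) : (sphere (0 : EuclideanSpace ℝ (Fin 2)) 1) × EuclideanSpace ℝ (Fin 2)).2))
      ((ψ, v) : (sphere (0 : EuclideanSpace ℝ (Fin 2)) 1) × EuclideanSpace ℝ (Fin 2)).1)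
      (0 : EuclideanSpace ℝ (Fin 1)) = 0 := map_zero _
  rw [h0, zero_add]
  -- the partial map in the fibre and the fibre arc
  set g : EuclideanSpace ℝ (Fin 2) → W := fun w => sphereTubeMap f (ψ, w) with hg
  have hg' : ContMDiffAt 𝓘(ℝ, EuclideanSpace ℝ (Fin 2)) (𝓡∂ 4) ∞ g v :=
    hF.comp v (contMDiffAt_const.prodMk contMDiffAt_id)
  have hgd : MDifferentiableAt 𝓘(ℝ, EuclideanSpace ℝ (Fin 2)) (𝓡∂ 4) g v := hg'.mdifferentiableAt (by simp)
  have hline : HasDerivAt (fun ε : ℝ => v + ε • ζ) ζ 0 := by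
    simpa using ((hasDerivAt_id (0 : ℝ)).smul_const ζ).const_add v
  have hld : MDifferentiableAt 𝓘(ℝ, ℝ) 𝓘(ℝ, EuclideanSpace ℝ (Fin 2)) (fun ε : ℝ => v + ε • ζ) 0 :=
    hline.hasFDerivAt.hasMFDerivAt.mdifferentiableAt
  have hcomp : (fun ε : ℝ => f.toFun (fibreArc ψ v ζ ε)) = g ∘ fun ε : ℝ => v + ε • ζ := rfl
  unfold tubeFibreFraming
  rw [hcomp, mfderiv_comp 0 (by simpa using hgd) hld]
  show mfderiv 𝓘(ℝ, EuclideanSpace ℝ (Fin 2)) (𝓡∂ 4) g (v + (0 : ℝ) • ζ)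
    (mfderiv 𝓘(ℝ, ℝ) 𝓘(ℝ, EuclideanSpace ℝ (Fin 2)) (fun ε : ℝ => v + ε • ζ) 0 (1 : ℝ)) = _
  rw [mfderiv_line, zero_smul, add_zero]

/-- **Continuity of fibre framings into `TW`**: along continuous data `ψ(x)`, `v(x)` (`‖v(x)‖ < 1`),
`ζ(x)` the fibre framings form a continuous map into the tangent bundle (the tangent map of the
sphere-tube map applied to the continuous section `x ↦ ((ψ x, v x), (0, ζ x))`). [folklore] -/
theorem continuous_tubeFibreFraming [IsManifold (𝓡∂ 4) ∞ W] (f : HandleAttachingMap 3 2 W)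
    {X : Type*} [TopologicalSpace X] {ψ : X → sphere (0 : EuclideanSpace ℝ (Fin 2)) 1}
    {v ζ : X → EuclideanSpace ℝ (Fin 2)} (hψ : Continuous ψ) (hv : Continuous v) (hζ : Continuous ζ)
    (hv1 : ∀ x, ‖v x‖ < 1) :
    Continuous fun x => (TotalSpace.mk' (EuclideanSpace ℝ (Fin 4)) (f.toFun (depthLine (ψ x) (v x) 0))
      (tubeFibreFraming f (ψ x) (v x) (ζ x)) : TangentBundle (𝓡∂ 4) W) := by
  haveI := Fact.mk (@finrank_euclideanSpace_fin ℝ _ 2)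
  set U : Set ((sphere (0 : EuclideanSpace ℝ (Fin 2)) 1) × EuclideanSpace ℝ (Fin 2)) :=
    (univ : Set (sphere (0 : EuclideanSpace ℝ (Fin 2)) 1)) ×ˢ ball (0 : EuclideanSpace ℝ (Fin 2)) 1 with hU_def
  have hU : IsOpen U := isOpen_univ.prod isOpen_ball
  have hmem : ∀ x, ((ψ x, v x) : (sphere (0 : EuclideanSpace ℝ (Fin 2)) 1) × EuclideanSpace ℝ (Fin 2)) ∈ U :=
    fun x => ⟨mem_univ _, by simpa using hv1 x⟩
  have hF := contMDiffOn_sphereTubeMap f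
  have hcont : ContinuousOn (tangentMapWithin ((𝓡 1).prod 𝓘(ℝ, EuclideanSpace ℝ (Fin 2))) (𝓡∂ 4)
      (sphereTubeMap f) U) (TotalSpace.proj ⁻¹' U) :=
    hF.continuousOn_tangentMapWithin (by simp) hU.uniqueMDiffOn
  -- the section `x ↦ ((ψ x, v x), (0, ζ x))` of `T(𝕊¹ × ℝ²)`
  set σ : X → TangentBundle ((𝓡 1).prod 𝓘(ℝ, EuclideanSpace ℝ (Fin 2)))
      ((sphere (0 : EuclideanSpace ℝ (Fin 2)) 1) × EuclideanSpace ℝ (Fin 2)) := fun x =>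
    (equivTangentBundleProd (𝓡 1) (sphere (0 : EuclideanSpace ℝ (Fin 2)) 1) 𝓘(ℝ, EuclideanSpace ℝ (Fin 2))
      (EuclideanSpace ℝ (Fin 2))).symm
      (zeroSection (EuclideanSpace ℝ (Fin 1)) (TangentSpace (𝓡 1) : sphere (0 : EuclideanSpace ℝ (Fin 2)) 1 → Type) (ψ x),
        (tangentBundleModelSpaceHomeomorph 𝓘(ℝ, EuclideanSpace ℝ (Fin 2))).symm (v x, ζ x)) with hσ_def
  have hσc : Continuous σ := by
    have he : Continuous (equivTangentBundleProd (𝓡 1) (sphere (0 : EuclideanSpace ℝ (Fin 2)) 1)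
        𝓘(ℝ, EuclideanSpace ℝ (Fin 2)) (EuclideanSpace ℝ (Fin 2))).symm :=
      (contMDiff_equivTangentBundleProd_symm (n := ∞)).continuous
    refine he.comp (Continuous.prodMk ?_ ?_)
    · exact (Bundle.Trivialization.continuous_zeroSection ℝ (F := EuclideanSpace ℝ (Fin 1))
        (E := (TangentSpace (𝓡 1) : sphere (0 : EuclideanSpace ℝ (Fin 2)) 1 → Type))).comp hψ
    · exact (tangentBundleModelSpaceHomeomorph 𝓘(ℝ, EuclideanSpace ℝ (Fin 2))).symm.continuous.comp (hv.prodMk hζ)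
  have hσmem : ∀ x, σ x ∈ TotalSpace.proj ⁻¹' U := fun x => hmem x
  refine ((hcont.comp_continuous hσc hσmem).congr fun x => ?_)
  -- pointwise identification
  have hσx : σ x = ⟨(ψ x, v x), ((0 : EuclideanSpace ℝ (Fin 1)), ζ x)⟩ := rfl
  rw [comp_apply, hσx, tangentMapWithin]
  refine tangentBundle_mk_eq rfl ?_
  show mfderivWithin ((𝓡 1).prod 𝓘(ℝ, EuclideanSpace ℝ (Fin 2))) (𝓡∂ 4) (sphereTubeMap f) U (ψ x, v x)
      (((0 : EuclideanSpace ℝ (Fin 1)), ζ x) : TangentSpace ((𝓡 1).prod 𝓘(ℝ, EuclideanSpace ℝ (Fin 2)))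
        ((ψ x, v x) : (sphere (0 : EuclideanSpace ℝ (Fin 2)) 1) × EuclideanSpace ℝ (Fin 2))) =
    tubeFibreFraming f (ψ x) (v x) (ζ x)
  rw [mfderivWithin_of_isOpen hU (hmem x)]
  exact (tubeFibreFraming_eq_mfderiv_prod f (ψ x) (hv1 x) (ζ x)).symm

/-! ### §3 Registered helper -/

/-- **Registered helper `helper_belt_fibreFraming` (node T3c-1 of NF6 `stub_steinRealisation`, stages
(3a)/(3c), wave 3, lead c5): the fibre framing of a 2-handle attaching map `h̄ : T → W` — the velocity of
`ε ↦ h̄ (depthLine ψ (v + εζ) 0)` at a sphere point (`‖v‖ < 1`) — is the push-forward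
`dh̄ (Dι⁻¹ (−(⟪v,ζ⟫/√(1-‖v‖²)) (ψ, 0) + (0, ζ)))` and is tangent to `∂W`.** [cite: Kirby1989, Ch. I §2] -/
theorem helper_belt_fibreFraming :
    ∀ {W : Type} [TopologicalSpace W] [ChartedSpace (EuclideanHalfSpace 4) W] [IsManifold (𝓡∂ 4) ∞ W]
      (f : Literature.Topology.FourManifolds.HandleAttachingMap 3 2 W)
      (ψ : Metric.sphere (0 : EuclideanSpace ℝ (Fin 2)) 1) (v ζ : EuclideanSpace ℝ (Fin 2)), ‖v‖ < 1 →
      mfderiv 𝓘(ℝ, ℝ) (𝓡∂ 4) (fun ε : ℝ => f.toFun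
        (Literature.Topology.FourManifolds.depthLine ψ (v + ε • ζ) 0)) 0 (1 : ℝ) =
        mfderiv (𝓡∂ 4) (𝓡∂ 4) f.toFun (Literature.Topology.FourManifolds.depthLine ψ v 0)
          ((Literature.Topology.FourManifolds.closedBallCoeDeriv
            ((Literature.Topology.FourManifolds.depthLine ψ v 0 : ↥(Literature.Topology.FourManifolds.handleTube 3 2)) :
              Metric.closedBall (0 : EuclideanSpace ℝ (Fin 4)) 1)).symm
            ((-(inner ℝ v ζ / Real.sqrt (1 - ‖v‖ ^ 2))) •
              Literature.Topology.FourManifolds.lamEmbed (ψ : EuclideanSpace ℝ (Fin 2)) +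
              Literature.Topology.FourManifolds.muEmbed ζ)) ∧
      mfderiv 𝓘(ℝ, ℝ) (𝓡∂ 4) (fun ε : ℝ => f.toFun
        (Literature.Topology.FourManifolds.depthLine ψ (v + ε • ζ) 0)) 0 (1 : ℝ) ∈
        Literature.Geometry.Symplectic.boundaryTangentSpace := by
  intro W _ _ _ f ψ v ζ hv
  exact ⟨tubeFibreFraming_eq_mfderiv f ψ hv ζ, tubeFibreFraming_mem_boundaryTangentSpace f ψ hv ζ⟩

end Summit.SmoothPoincare4.SmoothPoincare4.Theorems.AcyclicBisectionExists.ModpBraidOrbits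

end
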